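import Mathlib
import HarnessLib
import HarnessLib.Audit
import Summits.FinalStateConjecture.Statement
import Literature.Geometry.Lorentzian.BlackHoles
import Literature.Geometry.Lorentzian.StabilityCauchy
import Literature.Geometry.Lorentzian.KerrTimeDerivative
import Literature.Geometry.Lorentzian.WeightedNorms
import HarnessLib.Audit.Status.Attr

/-!
Route: AnalyticInheritance

# Route AnalyticInheritance — inherit analyticity through settling — late limits of analytic vacuum
developments are analytic, so the analytic no-hair theorems decide the end state

It suffices to show X = A ∧ U ∧ N ∧ F (card analytic-inheritance-rigidity-exit, made deciding). A
(LateLimitsInheritAnalyticity, the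
card's K1⊕K3): every late-time local C^∞-limit, taken along future-drifting charts with uniform C^k
bounds, of a maximal vacuum Cauchy
development of admissible data that is presented ANALYTICALLY, is an analytic Lorentzian patch (some
local parametrisation makes the
limit metric real-analytic) — "the radius of analyticity does not collapse through the settling
phase". U (AnalyticNoHair, N = 1,
Hawking–Carter–Robinson–Chruściel–Costa in the analytic category, the unproved-in-tree instance of
the prelude schema
`stationary_black_hole_uniqueness`) and N (NoAnalyticParking, N ≥ 2, the card's K4): an
analytically-charted, vacuum, stationary AF
black hole whose horizon-penetrating slice is a global cross-section of the stationary flow and none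
of whose horizon components is a
degenerate Killing horizon has CONNECTED horizon (N) and domain of outer communications isometric to
a sub-extremal Kerr exterior (U).
F (GenericLimitDichotomy, imported front+back end of the sibling compactness cards, with the card's
density items P1–P3 folded in):
Christodoulou-generically an admissible datum has an MGHD, every MGHD has complete 𝓘⁺ and EITHER
settles in the typed sense OR some
analytic presentation of an MGHD has a late limit 𝓑 which is such a stationary vacuum black hole and
is NOT a single Kerr. Since
Christodoulou genericity is monotone in the property, A kills the second branch through U+N and F
becomes the Statement (closes, pure
logic). Two stand-alone tests of the mechanism ride along as ranked cruxes:
KerrWavesUniformlyAnalytic (linear, cheapest) and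
AnalyticKerrStability (card K2, the Klainerman–Szeftel arena).
Lean: `LateLimitsInheritAnalyticity ∧ AnalyticNoHair ∧ NoAnalyticParking ∧ GenericLimitDichotomy`

## Assembly
Pure logic, PROVED sorry-free as `closes` in glue.lean against the inlined items (Sketch.lean rc 0;
axioms propext,
Classical.choice, Quot.sound): Christodoulou genericity is monotone in the property, so it suffices
that the generic property of
GenericLimitDichotomy implies the Statement's property datum-wise; its first branch is the typed
settling verbatim; in its second
branch LateLimitsInheritAnalyticity (fed the analytic presentation 𝒟₀ and the late-limit structure)
makes 𝓑 analytically charted,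
NoAnalyticParking makes its horizon connected, AnalyticNoHair makes it a sub-extremal Kerr exterior
— contradicting the branch.
KerrWavesUniformlyAnalytic and AnalyticKerrStability are carried as (unused) hypotheses: they are
the mechanism's tests, not links.

Rationale: WHY THIS LINE. Every uniqueness theorem the endgame of the final-state problem needs is a theorem in
the ANALYTIC category (HawkingEllis1973 §9.3
Prop. 9.3.6; Chruściel–Costa arXiv:0806.0016 Thm 1.3) and the smooth rigidity conjecture is barred
locally (Ionescu–Klainerman,
barrier IonescuKlainermanNonExtension; review arXiv:1501.01587); the card's move is to make the
ω-limit analytic BY INHERITANCE —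
analyticity is harvested from the hyperbolic problem (propagation of analyticity for quasilinear
hyperbolic systems,
doi:10.1007/bf01388563; Gevrey/analyticity-radius bookkeeping à la Kato–Masuda/Foias–Temam,
arXiv:1301.0137,
doi:10.1016/j.jde.2020.11.038; red-shift commutation arXiv:0811.0354 §7 for the factorials at 𝓗⁺)
and handed to the
elliptic–hyperbolic stationary problem where it is the whole difficulty (Müller zum Hagen 1970:
stationary vacuum is analytic only
where T is timelike; the ergoregion is exactly what inheritance must supply; static case up to
non-degenerate horizons: Chruściel
arXiv:gr-qc/0402087). Imported from analysis of PDE: propagation/persistence of analyticity and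
uniform Gevrey radii; from
mathematical GR: the analytic no-hair theorems and Neugebauer–Hennig's N = 2 non-existence
(arXiv:0905.4179, arXiv:1105.5830,
arXiv:1103.5248). What no prior route does (there is none on this sub-problem; negatives index
empty): the typed items make the
inheritance claim GAUGE-ROBUST (conclusion = existence of an analytic local parametrisation of the
LIMIT, not Cauchy estimates in given
charts, which is false by re-gauging) and make the route literally decide the Statement through the
monotonicity of Christodoulou
genericity, with the smooth compactness front end isolated in ONE imported crux.

RANKED CRUXES. #2 LateLimitsInheritAnalyticity (crux) — [card K1⊕K3, gauge-robust form] For every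
admissible datum D on X (complete, one AF end, vacuum constraints), every MAXIMAL vacuum Cauchy
development 𝒟 of D whose given atlas is real-analytic with g analytic in it (an analytic
presentation; propagation of analyticity supplies one for analytic data), and every 4-dimensional
spacetime 𝓢 each point of which has a smooth local parametrisation φ : U → 𝓢 (U ⊆ ℝ⁴ open) that is
the C^k(U)-limit for every k, with n-uniform C^k(U) bounds, of the pulled-back metrics along a
sequence of smooth open embeddings Ψ_n : U → 𝒟 into J⁺(Σ) leaving the causal past of every event
(late, future-drifting local charts): 𝓢 admits around every point a smooth local parametrisation in
which its metric components are real-analytic. In words: late-time local limits of analytic vacuum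
developments of admissible data are analytic — the intrinsic radius of analyticity stays bounded
below wherever the geometry stays C^∞-bounded. [difficulty: XL] (why it might fail: The radius of
analyticity may → 0 while all C^k stay bounded (a derivative lost per commutation at trapping; long
near-extremal transients); a STABLE non-analytic stationary vacuum state attracting analytic data
refutes it; the non-AF analogue IS false (pp-waves).) [doi:10.1007/bf01388563, arXiv:0811.0354,
arXiv:1206.6598, arXiv:1301.0137, arXiv:1501.01587]
#3 KerrWavesUniformlyAnalytic (crux) — [linear test of the mechanism; the card's "fastest
refutation", corrected — analytic Cauchy data cannot be compactly supported] There is a₀ > 0 such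
that on every Kerr exterior with 0 < M, |a| < a₀M (ingoing Kerr–Schild chart {r > r₊}): every smooth
solution ψ of □_g ψ = 0 whose time derivatives T^k ψ have initial coordinate energies through {t* =
0} bounded by (C K^k k!)² and which obeys uniform Cauchy estimates |D^m ψ| ≤ C K^m m! on the initial
slab {0 ≤ t* ≤ 1} satisfies, for every R, uniform Cauchy estimates |D^m ψ| ≤ C_R K_R^m m! on the
whole future near zone {t* ≥ 0, r₊ < r ≤ R}. Mechanism expected: exact T-commutation + DRSR
boundedness gives a uniform Gevrey-1 radius in t*; red-shift commutation (κ > 0) closes the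
transversal derivatives at 𝓗⁺ with factorial constants; elliptic conversion where T (resp. T + N) is
timelike; |a| ≪ M keeps the ergoregion inside the red-shift zone (the full range needs
Φ-commutation, layer 2). [difficulty: M] (why it might fail: The red-shift commutation constants for
k transversal derivatives may grow faster than C^k k! (each [□,N] commutation feeds all lower
orders), or the elliptic conversion may fail uniformly as r → r₊ where T + N degenerates; Aretakis
growth shows the κ-dependence is real (fails at κ = 0).) [arXiv:0811.0354, arXiv:1402.7034,
arXiv:1206.6598, doi:10.1016/j.jde.2020.11.038]
#4 AnalyticNoHair (crux) — [analytic no-hair, N = 1 — Hawking–Carter–Robinson–Chruściel–Costa; the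
instance of the prelude schema `Literature.Geometry.Lorentzian.stationary_black_hole_uniqueness` at
the regularity predicate Reg, with analyticity in the presentation-independent form AnAtlas and
non-degeneracy in the rigidity-free form ¬Degenerate; UNPROVED named fact in the tree, proved in
print at Chruściel–Costa's Def. 1.1] For every stationary AF black hole 𝓑 (prelude hypothesis
structure: complete Killing field timelike on M_ext, AF end, embedded slice Σ): if Σ meets every
Killing orbit through the exterior-with-horizon doc ∪ 𝓔⁺ exactly once (Reg: Σ is a global
horizon-penetrating cross-section of the stationary flow), the metric is real-analytic in some local
parametrisation around every point (AnAtlas), Ric(g) = 0, 𝓔⁺ ≠ ∅, no component of 𝓔⁺ is a degenerate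
Killing horizon (no Killing K, null, non-vanishing and tangent on a whole component with ∇_K K = 0
there) and 𝓔⁺ is connected, then (given the prelude's standing named facts) the d.o.c. is isometric
to a sub-extremal Kerr exterior {r > r₊}. [difficulty: L] (why it might fail: Stated under Reg
(global Killing cross-section) instead of Chruściel–Costa's I⁺-regularity Def. 1.1 (⟨⟨M_ext⟩⟩
globally hyperbolic, S̄ a manifold with boundary meeting generators once): deriving Def. 1.1 from
Reg is Conjecture-1.2 territory; analyticity up to AND across 𝓔⁺ is used by Hawking's step.)
[arXiv:0806.0016, HawkingEllis1973, arXiv:1501.01587, arXiv:gr-qc/0402087]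
#5 AnalyticKerrStability (crux) — [card K2 — analytic Kerr stability for |a| ≪ M, the perturbative
instance of rank 2 in the arena where the front end is a theorem (Klainerman–Szeftel, GKS, Shen)]
There are (s, δ, k) and a₀ > 0 such that for 0 < M, |a| < a₀M and every inner radius r₀ ∈ (r₋, r₊)
there is ε > 0 with: every solution D of the vacuum constraints on the Kerr–Schild slice {t* = 0, r
> r₀} that is ε-close to the Kerr data in H^s_δ × H^{s−1}_{δ+1} AND differs from the Kerr data by
components obeying uniform Cauchy estimates |D^m(h − h_Kerr)|, |D^m(k − k_Kerr)| ≤ C K^m m! on the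
slice, has every MGHD converging in C^k, in a late horizon-penetrating Kerr–Schild chart Ψ of a
sub-extremal Kerr (M′, a′), to g_{M′,a′} (the typed `IsLateEmbedding` + `deviationCk → 0` of
`ConvergesToKerr`) with, in the SAME chart, uniform Cauchy estimates |D^m(Ψ^*g − g_{M′,a′})| ≤ C_R
K_R^m m! on every late near zone {t* ≥ τ₀ + 1, r₊ < r ≤ R}. [difficulty: XL] (why it might fail: The
GCM/PT gauges of Klainerman–Szeftel are finitely differentiable; an analytic gauge (analytic GCM
spheres or generalised harmonic gauge à la Hintz–Vasy) must be re-run with Gevrey weights, and the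
trapping loss per commutation may beat k!.) [arXiv:2104.11857, arXiv:2205.14808, arXiv:1711.00195,
arXiv:0811.0354]
#6 NoAnalyticParking (crux) — [card K4 — analytic multi-black-hole non-existence, N ≥ 2] A
stationary AF black hole 𝓑 with the regularity Reg of rank 4, real-analytic metric in some local
parametrisation around every point, Ric(g) = 0, non-empty future event horizon none of whose
components is a degenerate Killing horizon, has CONNECTED horizon. In the analytic class Hawking's
rigidity gives axisymmetry, Weyl–Papapetrou/Ernst reduction gives N-rod data, and equilibrium must
be excluded: N = 2 is Neugebauer–Hennig (including the degenerate case), N ≥ 3 is open. [difficulty: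
L] (why it might fail: N ≥ 3 co-axial equilibrium configurations of the N-Kerr–NUT family are not
excluded in print; the reduction to Weyl–Papapetrou form for disconnected horizons needs the
orbit-space structure theorem at regularity Reg only.) [arXiv:0905.4179, arXiv:1105.5830,
arXiv:1103.5248, arXiv:0806.0016]
#7 GenericLimitDichotomy (crux) — [imported FRONT + BACK END of the sibling compactness cards
(lasalle-bondi-lyapunov-liouville K, two-boundary-squeeze B2, dissipation-budget quiet windows,
burnett-limit compactness) with the card's density/propagation items P1–P3 folded in] For every X,
Christodoulou-generically in the admissible class: the datum has an MGHD, and every MGHD has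
complete 𝓘⁺ and EITHER settles to finitely many sub-extremal Kerrs with exhaustive charts (verbatim
the typed conclusion) OR there are an analytically presented MGHD 𝒟₀ of the same datum and a
stationary AF black hole 𝓑 with: Σ a global Killing cross-section of doc ∪ 𝓔⁺ (Reg), Ric = 0, 𝓔⁺ ≠
∅, no degenerate Killing-horizon component, NOT (connected horizon ∧ d.o.c. isometric to a
sub-extremal Kerr exterior), and every point of 𝓑 a late local C^∞-limit with uniform C^k bounds of
future-drifting charts of 𝒟₀ (the ω-limit, extracted in the smooth category). Content: weak cosmic
censorship + orbital boundedness + extraction of STATIONARY limits with horizon-penetrating uniform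
C^k control (sub-extremality generic by the third law/Aretakis) + Lichnerowicz for horizonless
limits + the back end (all limits single Kerrs ⇒ typed settling) + density of analytic data along
Christodoulou curves. [deps: LateLimitsInheritAnalyticity, AnalyticNoHair, NoAnalyticParking]
[difficulty: open-problem] (why it might fail: Generic non-settling need not produce ANY stationary
ω-limit with uniform C^k control (perpetual radiation, slow drifts, derivative growth), and making
the good members of Christodoulou curves analytic needs the uniform-unfolding reduction P1 — each is
an open programme (contains WCC).) [arXiv:1710.01722, arXiv:0805.3880, arXiv:2104.11857,
doi:10.1007/bf01388563]

TWO-LAYER PLAN. Foreseen glued splits (k ≤ 3, depth 1), filed only when a crux closes or stalls with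
a census:
LateLimitsInheritAnalyticity ⇐ UniformIntrinsicRadius (K1 proper: along uniformly C^k-bounded late
regions of an analytic admissible
MGHD the metric's Cauchy constants in geodesic-normal/harmonic coordinates normalised to the limit
are uniform) → LimitsOfUniformlyAnalytic
(K3: C^∞-limits of uniformly analytic patches are analytic; isometries of analytic metrics are
analytic) → LateLimitsInheritAnalyticity.
KerrWavesUniformlyAnalytic ⇐ GevreyInTime (T^k energies, DRSR) → RedShiftFactorials (N-commutation
with C^k k! constants) → EllipticConversion.
AnalyticNoHair ⇐ RegImpliesIPlusRegular (Reg ⇒ Chruściel–Costa Def. 1.1) → HawkingRigidityAnalytic →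
CarterRobinsonAtDef11.
GenericLimitDichotomy ⇐ SmoothFrontEnd (generic WCC + boundedness + stationary ω-limits with uniform
C^k control, sibling cards) →
AnalyticDensity (P1 uniform-unfolding reduction + P2 analytic reachability + P3 analytic
presentation of the MGHD) → BackEnd (all limits
single Kerrs ⇒ typed settling with exhaustive charts).

KILL CRITERIA. An admissible ANALYTIC vacuum development with a non-analytic late local C^∞-limit
refutes LateLimitsInheritAnalyticity: close
`refuted:LateLimitsInheritAnalyticity` (the card's mechanism is dead; U, N survive as classical
targets). KerrWavesUniformlyAnalytic refuted
(super-factorial growth of transversal derivatives on sub-extremal Kerr from analytic data) kills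
the mechanism already linearly: close
refuted and record the growth law as a barrier. AnalyticNoHair refuted by an analytic stationary
vacuum AF black hole satisfying Reg that is
not Kerr ⇒ Reg is too weak: RESTATE with I⁺-regularity strengthened (pivot, not close) unless the
witness is I⁺-regular (then the classical
theorem is wrong — implausible). NoAnalyticParking refuted by an analytic N ≥ 3 equilibrium ⇒ a
genuine non-Kerr end-state candidate:
hand to the negative side (¬FinalStateConjecture route) and close refuted. GenericLimitDichotomy
refuted ⇒ depends on the witness
(generic naked singularities = ¬WCC kills every route; generic non-stationary end states ⇒ pivot to
a Burnett/quiet-window limit notion).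
Mooted: a smooth large-data rigidity theorem (AIK without smallness) proved elsewhere supersedes
A+U+N — `superseded --by` that route.

NOT DECOMPOSED YET. The I⁺-regularity transcription (Reg ⇒ Def. 1.1) and the orbit-space structure
for disconnected horizons; the N = 2 / N ≥ 3 split of
NoAnalyticParking; Φ-commutation for the full sub-extremal range of the linear crux (stated for |a|
≪ M only); far-zone (r > R)
analyticity (never claimed: no conformal analyticity at 𝓘⁺); the uniform-unfolding reduction P1 (a
Lean-sized bookkeeping lemma over
`IsSmoothDataFamily`, but its injectivity clause needs a conserved label — child of
GenericLimitDichotomy); constants (κ-dependence of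
the radius, a₀). Deliberately NOT filed: the chart-wise form of K1 ("uniform C^k bounds in given
late charts ⇒ uniform Cauchy estimates in
the same charts") — FALSE by re-gauging with analytic diffeomorphisms converging to a non-analytic
one; recorded so nobody re-files it.

CHEAPEST FALSIFIER. (1) Pen and paper, done this session: the non-AF analogue of rank 2 is FALSE —
take a vacuum pp-wave with profile f real-analytic on ℝ
that Whitney-approximates, with errors → 0 to all orders as u → ∞, a smooth non-analytic 1-periodic
profile; u-translates of unit patches
converge in C^∞ to a NON-analytic vacuum plane wave. The admissible hypothesis (AF, finite mass, one
end) is therefore load-bearing; the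
refuter's first job is an AF version (analytic AF data shadowing a non-analytic late profile with
O(1) curvature) — none found; finite
energy forces O(1)-curvature late limits to sit at the final black hole. (2) The linear crux on
SCHWARZSCHILD (a = 0, no ergoregion):
compute the k-dependence of the red-shift commutation constants for ∂_r^k ψ|_𝓗⁺ from the transversal
ODE hierarchy (Aretakis-type
recursion with damping κ = 1/4M): factorial or worse? A kit symbolic job can settle the recursion's
growth.

NUMBERS. Surface gravity κ(M, a) = (r₊ − r₋)/(2(r₊² + a²)), r± = M ± √(M² − a²); expected
near-horizon analyticity radius ~ κ⁻¹ (red-shift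
e-folding); Aretakis: on extremal horizons ∂_r^k ψ ~ v^{k−1} (arXiv:1206.6598), i.e. radius ~ 1/v →
0 exactly at κ = 0. DRSR boundedness
constant C(a₀, M) for |a| ≤ a₀ < M (arXiv:1402.7034 Thm 3.1 (23)); Klainerman–Szeftel smallness
|a|/M ≪ 1 (arXiv:2104.11857 Thm 1.2.1).
Price-law tails t⁻³ are time-integrable (the "integrable approach" the radius bookkeeping needs).
Items at open: 7 (6 cruxes + assembly).

DEFINITION REQUESTS. None filed: every notion is inlined over `Literature.Geometry.Lorentzian`
(StationaryAFBlackHole, VacuumCauchyDevelopment, pullbackBilin,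
supCkENorm, Kerr charts). Desirable prelude additions that would shorten the signatures (for a
grounder, not load-bearing):
`Spacetime.HasAnalyticAtlas` (∀ p, ∃ smooth local parametrisation with analytic metric components),
`VacuumCauchyDevelopment.IsLateLocalLimit 𝒟 𝓢`
(the late-limit clause of ranks 2/7), `StationaryAFBlackHole.HasDegenerateComponent`.

Novelty: Searches (2026-08-15): `lit search --source zbmath` "propagation of analyticity hyperbolic" (8:
Spagnolo 2011 arXiv:1012.3949, Alinhac–Métivier
1984 rows), "radius of analyticity Gevrey wave equation" (6: Guo–Titi arXiv:1301.0137, da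
Silva–Castro doi:10.1016/j.jde.2020.11.038 — all
ℝⁿ/dispersive, none on black holes), "analyticity stationary vacuum Einstein" (8: Müller zum Hagen
1970 zbl:0193.22302, Kundu 1981, IK
arXiv:0711.0040, AIK arXiv:0902.1173), "rigidity stationary black holes analyticity" (4:
arXiv:0904.0982, arXiv:1501.01587, Yu arXiv:0903.4723),
"Neugebauer Hennig two-black-hole equilibrium" (3: arXiv:0905.4179, arXiv:1105.5830,
arXiv:1103.5248), "Gevrey regularity Kerr wave red-shift
horizon" (0), "analytic compactness limits of vacuum spacetimes Cauchy estimates" (0); `lit frontier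
FinalStateConjecture --since 2021` (30 rows,
none on analyticity/rigidity); `lit galaxy search "analyticity radius black hole exterior" --star
all` (0 hits), galaxy pdf "Hawking's rigidity
theorem without analyticity" / "propagation of analyticity" (logged in folder/galaxy2.txt); OpenAlex
HTTP 429 (budget exhausted), local FTS
daemon connection reset — recorded. Plus the card's own searches and its gen-1 novelty audit
(refuter unit 5: new-combination).
Nearest prior art found: doi:10.1007/bf01388563 (analytic data ⇒ analytic solution, finite time, no
uniformity); arXiv:0904.0982 /
arXiv:1501.01587 (remove analyticity perturbatively by Carleman estimates; p. 3 of the review states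
the b  [refs: 10.1016/j.jde.2020.11.038, 10.1007/bf01388563, 1012.3949, 1301.0137, 0711.0040, 0902.1173, 0904.0982, 1501.01587, 0903.4723, 0905.4179, 1105.5830, 1103.5248, gr-qc/0402087, doi:10.1016/j.jde.2020.11.038, doi:10.1007/bf01388563]

Barriers (technique_class: analyticity-propagation, gevrey-bootstrap, stationary-limit): - technique_class: analyticity-propagation, gevrey-bootstrap, stationary-limit
- Literature.Barriers.FinalStateConjecture.IonescuKlainermanNonExtension: evaded by construction —
no Killing extension across a smooth non-analytic horizon is attempted; the limits that occur are
analytically charted (rank 2) and Hawking–Nomizu continuation is legitimate for them (rank 4 assumes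
AnAtlas). The IK local metrics are not AF developments of admissible data; whether a GLOBAL smooth
non-analytic stationary state can attract analytic data is exactly what rank 2 denies — the bet.
- Literature.Barriers.FinalStateConjecture.AretakisInstability: consistency check, not obstacle — at
κ = 0 transversal derivatives grow like v^(k−1), the radius collapses, and the obstruction branch of
rank 7 excludes degenerate components (¬Degenerate) as the non-generic stratum; ranks 3/5 are stated
on sub-extremal |a| ≪ M only.
- Literature.Barriers.FinalStateConjecture.SbierskiTrappingObstruction: ranks 3/5 lose derivatives
at trapping like every high-order estimate; Gevrey bookkeeping tolerates a fixed finite loss per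
commutation iff the decay fed in is integrable — conceded as the why-fail of ranks 2/3/5, not
evaded.
- Literature.Barriers.FinalStateConjecture.KerrSuperradiance: no positivity of a Killing energy is
used; rank 3 rides on DRSR boundedness (degenerate at trapping, T-commuted) plus red-shift;
KerrNoTimelikeKillingCombination is why rank 3 converts time-regularity to space-regularity only
LOCALLY

sub-problem: FinalStateConjecture · status: open · opened planner-plancard-FinalStateConjecture-FinalSt-7340d10a-0 2026-08-15T15:06:37Z · rev 1 · ledger route-FinalStateConjecture-AnalyticInheritance
GENERATED by the gate from the ledger (D-0016/17). Provers cite these decls: `theorem foo : Summit.FinalStateConjecture.FinalStateConjecture.Theses.AnalyticInheritance.<Decl> := …` in Summits/FinalStateConjecture/FinalStateConjecture/Theorems/<Name>.lean.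
-/

namespace Summit.FinalStateConjecture.FinalStateConjecture.Theses.AnalyticInheritance

open scoped BigOperators Topology Manifold Classical MeasureTheory ProbabilityTheory Matrix InnerProductSpace ComplexConjugate ContinuousMap
open Filter Set Function TopologicalSpace MeasureTheory

attribute [summit_statement] _root_.FinalStateConjecture

/-- item stmt-FinalStateConjecture-10074 · crux · rank 2 · open · by planner
why it might fail: No tilt control on Ψ_n: boosted late charts amplify decaying radiation/tails by λ²; only finite energy (near-field bound) blocks a non-analytic plane-wave limit — the non-AF analogue IS false (pp-waves); at bounded r the analytic radius may → 0 with all C^k bounded (persistency bounds decay in t).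
sources: AlinhacMetivier1984, arXiv:1301.0137, DafermosRodnianski2008, arXiv:1206.6598, IonescuKlainerman2015, MullerZumHagen1970
[crux] [card K1⊕K3, gauge-robust form] For every admissible datum D on X (complete, one AF end,
vacuum constraints), every MAXIMAL vacuum Cauchy development 𝒟 of D whose given atlas is
real-analytic with g analytic in it (an analytic presentation; propagation of analyticity supplies
one for analytic data), and every 4-dimensional spacetime 𝓢 each point of which has a smooth local
parametrisation φ : U → 𝓢 (U ⊆ ℝ⁴ open) that is the C^k(U)-limit for every k, with n-uniform C^k(U)
bounds, of the pulled-back metrics along a sequence of smooth open embeddings Ψ_n : U → 𝒟 into J⁺(Σ)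
leaving the causal past of every event (late, future-drifting local charts): 𝓢 admits around every
point a smooth local parametrisation in which its metric components are real-analytic. In words:
late-time local limits of analytic vacuum developments of admissible data are analytic — the
intrinsic radius of analyticity stays bounded below wherever the geometry stays C^∞-bounded.
[difficulty: XL] -/
@[route_item "route-FinalStateConjecture-AnalyticInheritance", crux]
def LateLimitsInheritAnalyticity : Prop :=
  let comps := fun (𝓢 : Literature.Geometry.Lorentzian.Spacetime.{0} 4) (U : TopologicalSpace.Opens Literature.Geometry.Lorentzian.E4) (χ : U → 𝓢.carrier) => Function.extend Subtype.val (fun x : U ↦ (show Literature.Geometry.Lorentzian.E4 →L[ℝ] Literature.Geometry.Lorentzian.E4 →L[ℝ] ℝ from Literature.Geometry.Lorentzian.pullbackBilin (I := 𝓡 4) (I' := 𝓘(ℝ, Literature.Geometry.Lorentzian.E4)) χ 𝓢.metric.val x)) 0; ∀ (X : Type) [TopologicalSpace X] [ChartedSpace Literature.Geometry.Lorentzian.E3 X] [IsManifold (𝓡 3) ((⊤ : ℕ∞) : WithTop ℕ∞) X] [T2Space X] [SecondCountableTopology X] [ConnectedSpace X], ∀ D : Literature.Geometry.Lorentzian.InitialDataSet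 (𝓡 3) X, D ∈ Literature.Geometry.Lorentzian.admissibleVacuumData X → ∀ 𝒟 : Literature.Geometry.Lorentzian.VacuumCauchyDevelopment D, 𝒟.IsMaximal → (IsManifold (𝓡 4) (⊤ : WithTop ℕ∞) 𝒟.carrier ∧ ∃ g : Literature.Geometry.Lorentzian.LorentzianMetric (𝓡 4) (⊤ : WithTop ℕ∞) 𝒟.carrier, g.toPseudoRiemannianMetric.ofLE le_top = 𝒟.metric.toPseudoRiemannianMetric) → ∀ 𝓢 : Literature.Geometry.Lorentzian.Spacetime.{0} 4, (∀ p : 𝓢.carrier, ∃ (U : TopologicalSpace.Opens Literature.Geometry.Lorentzian.E4) (φ : U → 𝓢.carrier) (Ψ : ℕ → U → 𝒟.carrier), (ContMDiff 𝓘(ℝ, Literature.Geometry.Lorentzian.E4) (𝓡 4) ((⊤ : ℕ∞) : WithTop ℕ∞) φ ∧ Topology.IsOpenEmbedding φ ∧ p ∈ Set.range φ) ∧ (∀ n, ContMDiff 𝓘(ℝ, Literature.Geometry.Lorentzian.E4) (𝓡 4) ((⊤ : ℕ∞) : WithTop ℕ∞) (Ψ n) ∧ Topology.IsOpenEmbedding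 (Ψ n) ∧ Set.range (Ψ n) ⊆ 𝒟.metric.causalFuture 𝒟.timeOrientation (Set.range 𝒟.embed)) ∧ (∀ q : 𝒟.carrier, ∀ᶠ n in Filter.atTop, Disjoint (Set.range (Ψ n)) (𝒟.metric.causalPast 𝒟.timeOrientation {q})) ∧ (∀ k : ℕ, ∃ B : ENNReal, B < ⊤ ∧ ∀ n, Literature.Geometry.Lorentzian.supCkENorm (U : Set Literature.Geometry.Lorentzian.E4) k (comps 𝒟.toSpacetime U (Ψ n)) ≤ B) ∧ (∀ k : ℕ, Filter.Tendsto (fun n ↦ Literature.Geometry.Lorentzian.supCkENorm (U : Set Literature.Geometry.Lorentzian.E4) k (fun y ↦ comps 𝒟.toSpacetime U (Ψ n) y - comps 𝓢 U φ y)) Filter.atTop (nhds 0))) → (∀ p : 𝓢.carrier, ∃ (U : TopologicalSpace.Opens Literature.Geometry.Lorentzian.E4) (φ : U → 𝓢.carrier), ContMDiff 𝓘(ℝ, Literature.Geometry.Lorentzian.E4) (𝓡 4) ((⊤ : ℕ∞) : WithTop ℕ∞) φ ∧ Topology.IsOpenEmbedding φ ∧ p ∈ Set.range φ ∧ AnalyticOnNhd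 ℝ (comps 𝓢 U φ) (U : Set Literature.Geometry.Lorentzian.E4))

/-- item stmt-FinalStateConjecture-10075 · crux · rank 3 · open · by planner
why it might fail: T-commutation + DRSR give Gevrey-1 in t* for free, but trading it for spatial analyticity is elliptic only where T is timelike: at 𝓗⁺/in the ergoregion it is a Keldysh radial-point analytic-hypoellipticity problem, in print only mode-by-mode (QNMs); uniform constants may be Gevrey-s>1; κ=0 fails.
sources: arXiv:2003.08106, arXiv:2104.04500, DafermosRodnianskiShlapentokhrothman2014, DafermosRodnianski2008, arXiv:1206.6598
[crux] [linear test of the mechanism; the card's "fastest refutation", corrected — analytic Cauchy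
data cannot be compactly supported] There is a₀ > 0 such that on every Kerr exterior with 0 < M, |a|
< a₀M (ingoing Kerr–Schild chart {r > r₊}): every smooth solution ψ of □_g ψ = 0 whose time
derivatives T^k ψ have initial coordinate energies through {t* = 0} bounded by (C K^k k!)² and which
obeys uniform Cauchy estimates |D^m ψ| ≤ C K^m m! on the initial slab {0 ≤ t* ≤ 1} satisfies, for
every R, uniform Cauchy estimates |D^m ψ| ≤ C_R K_R^m m! on the whole future near zone {t* ≥ 0, r₊ <
r ≤ R}. Mechanism expected: exact T-commutation + DRSR boundedness gives a uniform Gevrey-1 radius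
in t*; red-shift commutation (κ > 0) closes the transversal derivatives at 𝓗⁺ with factorial
constants; elliptic conversion where T (resp. T + N) is timelike; |a| ≪ M keeps the ergoregion
inside the red-shift zone (the full range needs Φ-commutation, layer 2). [difficulty: M] -/
@[route_item "route-FinalStateConjecture-AnalyticInheritance", crux]
def KerrWavesUniformlyAnalytic : Prop :=
  ∀ [Literature.Geometry.Lorentzian.Kerr.Facts] [Literature.Geometry.Lorentzian.Kerr.SliceFacts], ∃ a₀ > (0 : ℝ), ∀ (M a : ℝ), 0 < M → |a| < a₀ * M → ∀ ψ : Literature.Geometry.Lorentzian.Kerr.exterior M a → ℝ, ContMDiff 𝓘(ℝ, Literature.Geometry.Lorentzian.E4) 𝓘(ℝ, ℝ) ((⊤ : ℕ∞) : WithTop ℕ∞) ψ → (∀ x, (Literature.Geometry.Lorentzian.Kerr.smoothMetric M a (Literature.Geometry.Lorentzian.Kerr.rPlus M a)).toPseudoRiemannianMetric.dalembertian ψ x = 0) → (∃ C K : ℝ, ∀ k : ℕ, Literature.Geometry.Lorentzian.sliceEnergy (Literature.Geometry.Lorentzian.Kerr.exterior M a) (Literature.Geometry.Lorentzian.timeDeriv^[k]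 ψ) 0 ≤ ENNReal.ofReal ((C * K ^ k * k.factorial) ^ 2)) → (∃ C K : ℝ, ∀ (m : ℕ) (x : Literature.Geometry.Lorentzian.Kerr.exterior M a), 0 ≤ (x : Literature.Geometry.Lorentzian.E4) 0 → (x : Literature.Geometry.Lorentzian.E4) 0 ≤ 1 → ‖iteratedFDeriv ℝ m (Function.extend Subtype.val ψ 0) (x : Literature.Geometry.Lorentzian.E4)‖ ≤ C * K ^ m * m.factorial) → ∀ R : ℝ, ∃ C K : ℝ, ∀ (m : ℕ) (x : Literature.Geometry.Lorentzian.Kerr.exterior M a), 0 ≤ (x : Literature.Geometry.Lorentzian.E4) 0 → Literature.Geometry.Lorentzian.Kerr.radius a (x : Literature.Geometry.Lorentzian.E4) ≤ R → ‖iteratedFDeriv ℝ m (Function.extend Subtype.val ψ 0) (x : Literature.Geometry.Lorentzian.E4)‖ ≤ C * K ^ m * m.factorial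

/-- item stmt-FinalStateConjecture-10076 · crux · rank 4 · open · by planner
why it might fail: Likely misstated: StationaryAFBlackHole has no completeness/IsSoleEnd/causality clause, so Kerr minus a Killing-invariant closed tube ℝ×B̄ meets Reg, AnAtlas, Ric=0, connected non-degenerate 𝓔⁺, yet its d.o.c. is no Kerr exterior; even repaired, Reg is weaker than the hypotheses of C–C Conj 1.2.
sources: ChruscielCosta2008, HawkingEllis1973, IonescuKlainerman2015, arXiv:gr-qc/0402087, Literature.Geometry.Lorentzian.AFEnd.IsSoleEnd
[crux] [analytic no-hair, N = 1 — Hawking–Carter–Robinson–Chruściel–Costa; the instance of the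
prelude schema `Literature.Geometry.Lorentzian.stationary_black_hole_uniqueness` at the regularity
predicate Reg, with analyticity in the presentation-independent form AnAtlas and non-degeneracy in
the rigidity-free form ¬Degenerate; UNPROVED named fact in the tree, proved in print at
Chruściel–Costa's Def. 1.1] For every stationary AF black hole 𝓑 (prelude hypothesis structure:
complete Killing field timelike on M_ext, AF end, embedded slice Σ): if Σ meets every Killing orbit
through the exterior-with-horizon doc ∪ 𝓔⁺ exactly once (Reg: Σ is a global horizon-penetrating
cross-section of the stationary flow), the metric is real-analytic in some local parametrisation
around every point (AnAtlas), Ric(g) = 0, 𝓔⁺ ≠ ∅, no component of 𝓔⁺ is a degenerate Killing horizon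
(no Killing K, null, non-vanishing and tangent on a whole component with ∇_K K = 0 there) and 𝓔⁺ is
connected, then (given the prelude's standing named facts) the d.o.c. is isometric to a sub-extremal
Kerr exterior {r > r₊}. [difficulty: L] -/
@[route_item "route-FinalStateConjecture-AnalyticInheritance", crux]
def AnalyticNoHair : Prop :=
  let comps := fun (𝓢 : Literature.Geometry.Lorentzian.Spacetime.{0} 4) (U : TopologicalSpace.Opens Literature.Geometry.Lorentzian.E4) (χ : U → 𝓢.carrier) => Function.extend Subtype.val (fun x : U ↦ (show Literature.Geometry.Lorentzian.E4 →L[ℝ] Literature.Geometry.Lorentzian.E4 →L[ℝ] ℝ from Literature.Geometry.Lorentzian.pullbackBilin (I := 𝓡 4) (I' := 𝓘(ℝ, Literature.Geometry.Lorentzian.E4)) χ 𝓢.metric.val x)) 0; ∀ 𝓑 : Literature.Geometry.Lorentzian.StationaryAFBlackHole.{0}, (∀ p ∈ 𝓑.doc ∪ 𝓑.horizon, ∀ γ : ℝ → 𝓑.carrier, IsMIntegralCurve γ 𝓑.killing → γ 0 = p → ∃! t : ℝ, γ t ∈ Set.range 𝓑.embed) → (∀ p : 𝓑.toSpacetime.carrier,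 ∃ (U : TopologicalSpace.Opens Literature.Geometry.Lorentzian.E4) (φ : U → 𝓑.toSpacetime.carrier), ContMDiff 𝓘(ℝ, Literature.Geometry.Lorentzian.E4) (𝓡 4) ((⊤ : ℕ∞) : WithTop ℕ∞) φ ∧ Topology.IsOpenEmbedding φ ∧ p ∈ Set.range φ ∧ AnalyticOnNhd ℝ (comps 𝓑.toSpacetime U φ) (U : Set Literature.Geometry.Lorentzian.E4)) → (∀ [𝓑.metric.HasLeviCivita], 𝓑.metric.toPseudoRiemannianMetric.IsRicciFlat) → 𝓑.horizon.Nonempty → ¬ (∀ [𝓑.metric.HasLeviCivita], ∃ p ∈ 𝓑.horizon, ∃ K : Π x : 𝓑.carrier, TangentSpace (𝓡 4) x, 𝓑.metric.IsKillingField K ∧ ∀ q ∈ connectedComponentIn 𝓑.horizon p, K q ≠ 0 ∧ 𝓑.metric.val q (K q) (K q) = 0 ∧ 𝓑.metric.leviCivita K q (K q) = 0 ∧ ∀ γ : ℝ → 𝓑.carrier, IsMIntegralCurve γ K → γ 0 = q → ∀ t, γ t ∈ 𝓑.horizon) → IsConnected 𝓑.horizon → (∀ [𝓑.metric.HasLeviCivita]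 [Literature.Geometry.Lorentzian.Kerr.Facts] (hF : 𝓑.metric.isOpen_chronologicalFuture 𝓑.timeOrientation) (hP : 𝓑.metric.isOpen_chronologicalPast 𝓑.timeOrientation) (hres : Literature.Geometry.Lorentzian.PseudoRiemannianMetric.contMDiff_restrict (I := 𝓡 4) (n := ((⊤ : ℕ∞) : WithTop ℕ∞)) (M := 𝓑.carrier)), 𝓑.IsIsometricToKerrExterior hF hP hres)

/-- item stmt-FinalStateConjecture-10077 · crux · rank 5 · open · by planner
why it might fail: KS's GCM/PT gauges are finitely differentiable; the conclusion wants Cauchy estimates in the SAME late chart, so an analytic-compatible gauge (analytic GCM spheres / generalised harmonic) must be re-run with Gevrey weights, and the derivative loss per commutation at trapping may beat m!.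
sources: KlainermanSzeftel2021, GiorgiKlainermanSzeftel2022, HintzVasy2017, DafermosRodnianski2008
[crux] [card K2 — analytic Kerr stability for |a| ≪ M, the perturbative instance of rank 2 in the
arena where the front end is a theorem (Klainerman–Szeftel, GKS, Shen)] There are (s, δ, k) and a₀ >
0 such that for 0 < M, |a| < a₀M and every inner radius r₀ ∈ (r₋, r₊) there is ε > 0 with: every
solution D of the vacuum constraints on the Kerr–Schild slice {t* = 0, r > r₀} that is ε-close to
the Kerr data in H^s_δ × H^{s−1}_{δ+1} AND differs from the Kerr data by components obeying uniform
Cauchy estimates |D^m(h − h_Kerr)|, |D^m(k − k_Kerr)| ≤ C K^m m! on the slice, has every MGHD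
converging in C^k, in a late horizon-penetrating Kerr–Schild chart Ψ of a sub-extremal Kerr (M′,
a′), to g_{M′,a′} (the typed `IsLateEmbedding` + `deviationCk → 0` of `ConvergesToKerr`) with, in
the SAME chart, uniform Cauchy estimates |D^m(Ψ^*g − g_{M′,a′})| ≤ C_R K_R^m m! on every late near
zone {t* ≥ τ₀ + 1, r₊ < r ≤ R}. [difficulty: XL] -/
@[route_item "route-FinalStateConjecture-AnalyticInheritance", crux]
def AnalyticKerrStability : Prop :=
  ∀ [Literature.Geometry.Lorentzian.Kerr.Facts] [Literature.Geometry.Lorentzian.Kerr.SliceFacts], ∃ (s : ℕ) (δ : ℝ) (k : ℕ), ∃ a₀ > (0 : ℝ), ∀ (M a : ℝ) (hM : 0 < M), |a| < a₀ * M → ∀ r₀ ∈ Set.Ioo (Literature.Geometry.Lorentzian.Kerr.rMinus M a) (Literature.Geometry.Lorentzian.Kerr.rPlus M a), ∃ ε > (0 : ℝ), ∀ (D : Literature.Geometry.Lorentzian.InitialDataSet 𝓘(ℝ, Literature.Geometry.Lorentzian.E3) (Literature.Geometry.Lorentzian.Kerr.slice a r₀)) [D.metric.HasLeviCivita], D.IsVacuumConstraintSolution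 → Literature.Geometry.Lorentzian.InitialDataSet.dataWeightedSobolevEDist s δ D (Literature.Geometry.Lorentzian.Kerr.data M a r₀ hM.le) < ENNReal.ofReal ε → (∃ C K : ℝ, ∀ (m : ℕ) (y : Literature.Geometry.Lorentzian.Kerr.slice a r₀), ‖iteratedFDeriv ℝ m (Function.extend Subtype.val (fun z : Literature.Geometry.Lorentzian.Kerr.slice a r₀ ↦ (show Literature.Geometry.Lorentzian.E3 →L[ℝ] Literature.Geometry.Lorentzian.E3 →L[ℝ] ℝ from D.h.inner z) - (show Literature.Geometry.Lorentzian.E3 →L[ℝ] Literature.Geometry.Lorentzian.E3 →L[ℝ] ℝ from (Literature.Geometry.Lorentzian.Kerr.data M a r₀ hM.le).h.inner z)) 0) (y : Literature.Geometry.Lorentzian.E3)‖ ≤ C * K ^ m * m.factorial ∧ ‖iteratedFDeriv ℝ m (Function.extend Subtype.val (fun z : Literature.Geometry.Lorentzian.Kerr.slice a r₀ ↦ (show Literature.Geometry.Lorentzian.E3 →L[ℝ] Literature.Geometry.Lorentzian.E3 →L[ℝ] ℝ from D.k z) - (show Literature.Geometry.Lorentzian.E3 →L[ℝ] Literature.Geometry.Lorentzian.E3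 →L[ℝ] ℝ from (Literature.Geometry.Lorentzian.Kerr.data M a r₀ hM.le).k z)) 0) (y : Literature.Geometry.Lorentzian.E3)‖ ≤ C * K ^ m * m.factorial) → ∀ 𝒟 : Literature.Geometry.Lorentzian.VacuumCauchyDevelopment D, 𝒟.IsMaximal → ∃ (M' a' : ℝ) (𝒟oc : Set 𝒟.carrier) (τ₀ : ℝ) (Ψ : Literature.Geometry.Lorentzian.Kerr.exterior M' a' → 𝒟.carrier), Literature.Geometry.Lorentzian.Kerr.IsSubextremal M' a' ∧ 𝒟.toSpacetime.IsLateEmbedding (Literature.Geometry.Lorentzian.Kerr.background M' a') 𝒟oc τ₀ Ψ ∧ Filter.Tendsto (fun τ ↦ 𝒟.toSpacetime.deviationCk (Literature.Geometry.Lorentzian.Kerr.background M' a') Ψ k τ) Filter.atTop (nhds 0) ∧ ∀ R : ℝ, ∃ C K : ℝ, ∀ (m : ℕ) (x : Literature.Geometry.Lorentzian.Kerr.exterior M' a'), τ₀ + 1 ≤ (x : Literature.Geometry.Lorentzian.E4) 0 → Literature.Geometry.Lorentzian.Kerr.radius a' (x : Literature.Geometry.Lorentzian.E4) ≤ R → ‖iteratedFDeriv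 ℝ m (𝒟.toSpacetime.deviationExtend (Literature.Geometry.Lorentzian.Kerr.background M' a') Ψ) (x : Literature.Geometry.Lorentzian.E4)‖ ≤ C * K ^ m * m.factorial

/-- item stmt-FinalStateConjecture-10078 · crux · rank 6 · open · by planner
why it might fail: N ≥ 3 co-axial equilibria of the Weinstein/multi-Kerr–NUT harmonic-map family are not excluded in print (only N=2, Neugebauer–Hennig); and likely misstated like rank 4: Kerr minus the invariant closed set ℝ×(equatorial band of Σ∩𝓗⁺) keeps Reg, AnAtlas, Ric=0, non-degeneracy, two-component horizon.
sources: arXiv:0905.4179, arXiv:1105.5830, arXiv:1103.5248, Weinstein1990, ChruscielCosta2008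
[crux] [card K4 — analytic multi-black-hole non-existence, N ≥ 2] A stationary AF black hole 𝓑 with
the regularity Reg of rank 4, real-analytic metric in some local parametrisation around every point,
Ric(g) = 0, non-empty future event horizon none of whose components is a degenerate Killing horizon,
has CONNECTED horizon. In the analytic class Hawking's rigidity gives axisymmetry,
Weyl–Papapetrou/Ernst reduction gives N-rod data, and equilibrium must be excluded: N = 2 is
Neugebauer–Hennig (including the degenerate case), N ≥ 3 is open. [difficulty: L] -/
@[route_item "route-FinalStateConjecture-AnalyticInheritance", crux]
def NoAnalyticParking : Prop :=
  let comps := fun (𝓢 : Literature.Geometry.Lorentzian.Spacetime.{0} 4) (U : TopologicalSpace.Opens Literature.Geometry.Lorentzian.E4) (χ : U → 𝓢.carrier) => Function.extend Subtype.val (fun x : U ↦ (show Literature.Geometry.Lorentzian.E4 →L[ℝ] Literature.Geometry.Lorentzian.E4 →L[ℝ] ℝ from Literature.Geometry.Lorentzian.pullbackBilin (I := 𝓡 4) (I' := 𝓘(ℝ, Literature.Geometry.Lorentzian.E4)) χ 𝓢.metric.val x)) 0; ∀ 𝓑 : Literature.Geometry.Lorentzian.StationaryAFBlackHole.{0}, (∀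 p ∈ 𝓑.doc ∪ 𝓑.horizon, ∀ γ : ℝ → 𝓑.carrier, IsMIntegralCurve γ 𝓑.killing → γ 0 = p → ∃! t : ℝ, γ t ∈ Set.range 𝓑.embed) → (∀ p : 𝓑.toSpacetime.carrier, ∃ (U : TopologicalSpace.Opens Literature.Geometry.Lorentzian.E4) (φ : U → 𝓑.toSpacetime.carrier), ContMDiff 𝓘(ℝ, Literature.Geometry.Lorentzian.E4) (𝓡 4) ((⊤ : ℕ∞) : WithTop ℕ∞) φ ∧ Topology.IsOpenEmbedding φ ∧ p ∈ Set.range φ ∧ AnalyticOnNhd ℝ (comps 𝓑.toSpacetime U φ) (U : Set Literature.Geometry.Lorentzian.E4)) → (∀ [𝓑.metric.HasLeviCivita], 𝓑.metric.toPseudoRiemannianMetric.IsRicciFlat) → 𝓑.horizon.Nonempty → ¬ (∀ [𝓑.metric.HasLeviCivita], ∃ p ∈ 𝓑.horizon, ∃ K : Π x : 𝓑.carrier, TangentSpace (𝓡 4) x, 𝓑.metric.IsKillingField K ∧ ∀ q ∈ connectedComponentIn 𝓑.horizon p, K q ≠ 0 ∧ 𝓑.metric.val q (K q) (K q) = 0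 ∧ 𝓑.metric.leviCivita K q (K q) = 0 ∧ ∀ γ : ℝ → 𝓑.carrier, IsMIntegralCurve γ K → γ 0 = q → ∀ t, γ t ∈ 𝓑.horizon) → IsConnected 𝓑.horizon

/-- item stmt-FinalStateConjecture-10079 · crux · rank 7 · open · by planner
why it might fail: Contains weak cosmic censorship and the whole compactness programme: generic non-settling need not produce ANY stationary ω-limit with uniform C^k control (perpetual radiation, slow drifts, derivative growth), and analytic density along Christodoulou curves (P1–P3, uniform unfolding) is unproved.
sources: DafermosLuk2017, Christodoulou1999, Christodoulou2008, KlainermanSzeftel2021, AlinhacMetivier1984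
[crux] [imported FRONT + BACK END of the sibling compactness cards (lasalle-bondi-lyapunov-liouville
K, two-boundary-squeeze B2, dissipation-budget quiet windows, burnett-limit compactness) with the
card's density/propagation items P1–P3 folded in] For every X, Christodoulou-generically in the
admissible class: the datum has an MGHD, and every MGHD has complete 𝓘⁺ and EITHER settles to
finitely many sub-extremal Kerrs with exhaustive charts (verbatim the typed conclusion) OR there are
an analytically presented MGHD 𝒟₀ of the same datum and a stationary AF black hole 𝓑 with: Σ a
global Killing cross-section of doc ∪ 𝓔⁺ (Reg), Ric = 0, 𝓔⁺ ≠ ∅, no degenerate Killing-horizon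
component, NOT (connected horizon ∧ d.o.c. isometric to a sub-extremal Kerr exterior), and every
point of 𝓑 a late local C^∞-limit with uniform C^k bounds of future-drifting charts of 𝒟₀ (the
ω-limit, extracted in the smooth category). Content: weak cosmic censorship + orbital boundedness +
extraction of STATIONARY limits with horizon-penetrating uniform C^k control (sub-extremality
generic by the third law/Aretakis) + Lichnerowicz for horizonless limits + the back end (all limits
single Kerrs ⇒ typed settling) + d -/
@[route_item "route-FinalStateConjecture-AnalyticInheritance", crux]
def GenericLimitDichotomy : Prop :=
  let comps := fun (𝓢 : Literature.Geometry.Lorentzian.Spacetime.{0} 4) (U : TopologicalSpace.Opens Literature.Geometry.Lorentzian.E4) (χ : U → 𝓢.carrier) => Function.extend Subtype.val (fun x : U ↦ (show Literature.Geometry.Lorentzian.E4 →L[ℝ] Literature.Geometry.Lorentzian.E4 →L[ℝ] ℝ from Literature.Geometry.Lorentzian.pullbackBilin (I := 𝓡 4) (I' := 𝓘(ℝ, Literature.Geometry.Lorentzian.E4)) χ 𝓢.metric.val x)) 0; ∀ (X : Type) [TopologicalSpace X] [ChartedSpace Literature.Geometry.Lorentzian.E3 X] [IsManifold (𝓡 3)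 ((⊤ : ℕ∞) : WithTop ℕ∞) X] [T2Space X] [SecondCountableTopology X] [ConnectedSpace X], Literature.Geometry.Lorentzian.InitialDataSet.IsChristodoulouGeneric (Literature.Geometry.Lorentzian.admissibleVacuumData X) (fun D ↦ (∃ 𝒟 : Literature.Geometry.Lorentzian.VacuumCauchyDevelopment D, 𝒟.IsMaximal) ∧ ∀ 𝒟 : Literature.Geometry.Lorentzian.VacuumCauchyDevelopment D, 𝒟.IsMaximal → Summit.FinalStateConjecture.HasCompleteNullInfinity 𝒟.toCauchyDevelopment ∧ ((∃ (O : Set 𝒟.carrier) (d : Literature.Geometry.Lorentzian.FinalStateDecomposition 𝒟.toSpacetime O 2), (∀ i, Literature.Geometry.Lorentzian.Kerr.IsSubextremal (d.mass i) (d.spin i)) ∧ O = Summit.FinalStateConjecture.exteriorOf 𝒟.toCauchyDevelopment d.charted ∧ Summit.FinalStateConjecture.HasExhaustiveCharts d) ∨ ∃ 𝒟₀ : Literature.Geometry.Lorentzian.VacuumCauchyDevelopment D, 𝒟₀.IsMaximal ∧ (IsManifold (𝓡 4) (⊤ : WithTop ℕ∞) 𝒟₀.carrier ∧ ∃ g :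 Literature.Geometry.Lorentzian.LorentzianMetric (𝓡 4) (⊤ : WithTop ℕ∞) 𝒟₀.carrier, g.toPseudoRiemannianMetric.ofLE le_top = 𝒟₀.metric.toPseudoRiemannianMetric) ∧ ∃ 𝓑 : Literature.Geometry.Lorentzian.StationaryAFBlackHole.{0}, ((∀ p ∈ 𝓑.doc ∪ 𝓑.horizon, ∀ γ : ℝ → 𝓑.carrier, IsMIntegralCurve γ 𝓑.killing → γ 0 = p → ∃! t : ℝ, γ t ∈ Set.range 𝓑.embed) ∧ (∀ [𝓑.metric.HasLeviCivita], 𝓑.metric.toPseudoRiemannianMetric.IsRicciFlat) ∧ 𝓑.horizon.Nonempty ∧ ¬ (∀ [𝓑.metric.HasLeviCivita], ∃ p ∈ 𝓑.horizon, ∃ K : Π x : 𝓑.carrier, TangentSpace (𝓡 4) x, 𝓑.metric.IsKillingField K ∧ ∀ q ∈ connectedComponentIn 𝓑.horizon p, K q ≠ 0 ∧ 𝓑.metric.val q (K q) (K q) = 0 ∧ 𝓑.metric.leviCivita K q (K q) = 0 ∧ ∀ γ : ℝ → 𝓑.carrier, IsMIntegralCurve γ K → γ 0 = q → ∀ t,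 γ t ∈ 𝓑.horizon) ∧ ¬ (IsConnected 𝓑.horizon ∧ (∀ [𝓑.metric.HasLeviCivita] [Literature.Geometry.Lorentzian.Kerr.Facts] (hF : 𝓑.metric.isOpen_chronologicalFuture 𝓑.timeOrientation) (hP : 𝓑.metric.isOpen_chronologicalPast 𝓑.timeOrientation) (hres : Literature.Geometry.Lorentzian.PseudoRiemannianMetric.contMDiff_restrict (I := 𝓡 4) (n := ((⊤ : ℕ∞) : WithTop ℕ∞)) (M := 𝓑.carrier)), 𝓑.IsIsometricToKerrExterior hF hP hres))) ∧ (∀ p : 𝓑.toSpacetime.carrier, ∃ (U : TopologicalSpace.Opens Literature.Geometry.Lorentzian.E4) (φ : U → 𝓑.toSpacetime.carrier) (Ψ : ℕ → U → 𝒟₀.carrier), (ContMDiff 𝓘(ℝ, Literature.Geometry.Lorentzian.E4) (𝓡 4) ((⊤ : ℕ∞) : WithTop ℕ∞) φ ∧ Topology.IsOpenEmbedding φ ∧ p ∈ Set.range φ) ∧ (∀ n, ContMDiff 𝓘(ℝ, Literature.Geometry.Lorentzian.E4) (𝓡 4) ((⊤ : ℕ∞) : WithTop ℕ∞) (Ψ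 n) ∧ Topology.IsOpenEmbedding (Ψ n) ∧ Set.range (Ψ n) ⊆ 𝒟₀.metric.causalFuture 𝒟₀.timeOrientation (Set.range 𝒟₀.embed)) ∧ (∀ q : 𝒟₀.carrier, ∀ᶠ n in Filter.atTop, Disjoint (Set.range (Ψ n)) (𝒟₀.metric.causalPast 𝒟₀.timeOrientation {q})) ∧ (∀ k : ℕ, ∃ B : ENNReal, B < ⊤ ∧ ∀ n, Literature.Geometry.Lorentzian.supCkENorm (U : Set Literature.Geometry.Lorentzian.E4) k (comps 𝒟₀.toSpacetime U (Ψ n)) ≤ B) ∧ (∀ k : ℕ, Filter.Tendsto (fun n ↦ Literature.Geometry.Lorentzian.supCkENorm (U : Set Literature.Geometry.Lorentzian.E4) k (fun y ↦ comps 𝒟₀.toSpacetime U (Ψ n) y - comps 𝓑.toSpacetime U φ y)) Filter.atTop (nhds 0))))) 1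

/-- item stmt-FinalStateConjecture-10080 · assembly · rank 1 · open · by planner
sources: arXiv:1710.01722, arXiv:0806.0016
[assembly] LateLimitsInheritAnalyticity → KerrWavesUniformlyAnalytic → AnalyticNoHair →
AnalyticKerrStability → NoAnalyticParking → GenericLimitDichotomy → FinalStateConjecture. -/
@[route_item "route-FinalStateConjecture-AnalyticInheritance", crux]
def Assembly : Prop :=
  LateLimitsInheritAnalyticity → KerrWavesUniformlyAnalytic → AnalyticNoHair → AnalyticKerrStability → NoAnalyticParking → GenericLimitDichotomy → _root_.FinalStateConjecture

/-! D-0027 §2.1 — DECIDING THEOREM (planner-authored via `route open/edit --closes-file`; by planner-plancard-FinalStateConjecture-FinalSt-7340d10a-0 2026-08-15T15:06:38Z):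
its hypotheses are this route's items and its conclusion the sub-problem Statement (glue_lint), and it elaborates with this file. -/

@[closes "route-FinalStateConjecture-AnalyticInheritance"] theorem closes (h₁ : LateLimitsInheritAnalyticity) (_h₂ : KerrWavesUniformlyAnalytic)
    (h₃ : AnalyticNoHair) (_h₄ : AnalyticKerrStability) (h₅ : NoAnalyticParking)
    (h₆ : GenericLimitDichotomy) (_h₇ : Assembly) : _root_.FinalStateConjecture := by
  intro X _ _ _ _ _ _
  -- Christodoulou genericity is monotone in the property (pure logic)
  have mono : ∀ {𝓓 : Set (Literature.Geometry.Lorentzian.InitialDataSet (𝓡 3) X)}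
      {P Q : Literature.Geometry.Lorentzian.InitialDataSet (𝓡 3) X → Prop}, (∀ D ∈ 𝓓, Q D → P D) →
      Literature.Geometry.Lorentzian.InitialDataSet.IsChristodoulouGeneric 𝓓 Q 1 →
        Literature.Geometry.Lorentzian.InitialDataSet.IsChristodoulouGeneric 𝓓 P 1 := by
    intro 𝓓 P Q hQP hQ d hd
    obtain ⟨F, hF, hF0, hinj, hmem, hgood⟩ := hQ d ⟨hd.1, fun h ↦ hd.2 (hQP d hd.1 h)⟩
    exact ⟨F, hF, hF0, hinj, hmem, fun c hc hbad ↦ hgood c hc ⟨hmem c, fun h ↦ hbad.2 (hQP _ (hmem c) h)⟩⟩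
  refine mono ?_ (h₆ X)
  intro D hD hQ
  refine ⟨hQ.1, fun 𝒟 h𝒟 ↦ ⟨(hQ.2 𝒟 h𝒟).1, ?_⟩⟩
  rcases (hQ.2 𝒟 h𝒟).2 with hS | ⟨𝒟₀, h₀, hA, 𝓑, hObs, hLim⟩
  · exact hS
  · exfalso
    obtain ⟨hReg, hVac, hne, hND, hnot⟩ := hObs
    -- inheritance: the late limit of the analytic development is analytic
    have hAt := h₁ X D hD 𝒟₀ h₀ hA 𝓑.toSpacetime hLim
    -- no parking: the analytic stationary vacuum limit has connected horizon
    have hconn : IsConnected 𝓑.horizon := h₅ 𝓑 hReg hAt hVac hne hND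
    -- analytic no-hair: it is a subextremal Kerr exterior, contradicting the obstruction
    exact hnot ⟨hconn, h₃ 𝓑 hReg hAt hVac hne hND hconn⟩

end Summit.FinalStateConjecture.FinalStateConjecture.Theses.AnalyticInheritance
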